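import Mathlib
import HarnessLib
import Literature.MathematicalPhysics.KineticTheory.HardSphereEulerProofs
import Summits.AtomisticToContinuum.HydrodynamicLimit.Theses.OneFlightGossipEngine
import Summits.AtomisticToContinuum.HydrodynamicLimit.Theorems.OneFlightGossipEngineKineticCurrentsLDAlongFamiliesKCWUSharpPlus
import Summits.AtomisticToContinuum.HydrodynamicLimit.Theorems.OneFlightGossipEngineKineticCurrentsLDAlongFamiliesKCWUSharpPlusOfPartsStatics
import Summits.AtomisticToContinuum.HydrodynamicLimit.Theorems.OneFlightGossipEngineKineticCurrentsWindowLDSplit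

/-!
# `KCWUSharpPlus ⟸ KCWUSharp ∧ KCWUSharpRadial` — the enlarged-class rung is EXACTLY the pair of
# v5b stubs (crux `KineticCurrentsLDAlongFamilies`, stmt-AtomisticToContinuum-16659, line `Sketch`)

Route `OneFlightGossipEngine`, sub-problem `HydrodynamicLimit`; lead prover-line-…-16659-c3-0 (cycle 4).
The certificate file `…KCWUSharpPlus.lean` (p137412) proved `KCWUSharpPlus ⟹ KCWUSharp`,
`KCWUSharpPlus ⟹ KCWUSharpRadial` and `KCWUSharpPlus ⟹ crux`. This file proves the CONVERSE
`KCWUSharp → KCWUSharpRadial → KCWUSharpPlus`, so that skeleton v6 (one stub `stub_kcwuSharpPlus`) and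
skeleton v5b (stubs `stub_kcwuSharp`, `stub_kcwuSharpRadial`) are provably equivalent.

Proof: split `F = F₁ + F₂` into its traceless structured part and its radial part
`K + (tr A/3)ρ` (statics in `…KCWUSharpPlusOfPartsStatics.lean`: both parts have growth
`C(7+10U²)(1+‖v‖²)` and are orthogonal to `1, v_j, ‖v‖²`), apply the two rungs at tilt `2β` with
the growth constant `C(7+10U²)`, and combine by Cauchy–Schwarz (`lintegral_exp_window_add_le`):
`β₀ := min(β₁, β₂)/2`, `η₀ := min(η₁, η₂)`, `τ₀ := max`, `N₀ := max`.
-/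

noncomputable section

open MeasureTheory Set Filter ProbabilityTheory
open scoped ENNReal Topology

namespace Summit.AtomisticToContinuum.HydrodynamicLimit.Theorems.KineticCurrentsLDAlongFamiliesSketch

open Literature.Analysis.FluidPDE (HardSphereFlow Config localMaxwellian)
open Literature.MathematicalPhysics.KineticTheory (T3 V3 hsDiameter localGibbsLaw)
open Literature.Analysis.FluidPDE Literature.MathematicalPhysics.KineticTheory

/-! ### The converse certificate -/

/-- **`KCWUSharp → KCWUSharpRadial → KCWUSharpPlus`.** The pointwise kinetic-window LD rung with a
numeric tilt threshold for the class ENLARGED by its radial sector follows from the rung for the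
structured class (v5b stub S1 `stub_kcwuSharp`) and the rung for the radial sector (v5b stub S1R
`stub_kcwuSharpRadial`): split `F = F₁ + F₂` (traceless structured part, radial part
`K + (tr A/3)ρ`), both of growth `C(7+10U²)(1+‖v‖²)` and orthogonal to `1, v_j, ‖v‖²`
(`PlusOfParts.split_orth`), apply the two rungs at tilt `2β` and combine by Cauchy–Schwarz
(`lintegral_exp_window_add_le`). With `kcwuSharp_of_kcwuSharpPlus`, `kcwuSharpRadial_of_kcwuSharpPlus`
(p137412) this makes skeleton v6's single stub `stub_kcwuSharpPlus` EQUIVALENT to v5b's pair. [folklore] -/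
theorem kcwuSharpPlus_of_kcwuSharp_of_kcwuSharpRadial :
    (∃ η₀ : ℝ, 0 < η₀ ∧ ∀ (Θ U C Λ : ℝ), 1 ≤ Θ → 0 ≤ U → 0 ≤ C → 1 ≤ Λ → ∀ σ : ℝ, 0 < σ →
        ∃ β₀ : ℝ, 0 < β₀ ∧
        ∀ (a θ₀ : T3 → ℝ) (u₀ : T3 → V3), Continuous a → Continuous θ₀ → Continuous u₀ →
        (∀ x, Λ⁻¹ ≤ a x ∧ a x ≤ Λ) → (∀ x, Θ⁻¹ ≤ θ₀ x ∧ θ₀ x ≤ Θ) → (∀ x, ‖u₀ x‖ ≤ U) →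
        σ ^ 3 * (⨆ x, a x) ≤ η₀ * ∫ x, a x →
        ∀ Φ : (N : ℕ) →
          HardSphereFlow (Torus.geometry (Fin 3)) (hsDiameter σ N) (N + 1),
        ∀ (A : T3 → Fin 3 → Fin 3 → ℝ) (b : T3 → V3) (G : T3 × ℝ → ℝ),
        Continuous A → Continuous b → Continuous G →
        ∀ F : T3 × V3 → ℝ, (∀ y, F y =
          (∑ j : Fin 3, ∑ k : Fin 3, A y.1 j k * ((y.2 - u₀ y.1) j * (y.2 - u₀ y.1) k)) +
            (∑ j : Fin 3, b y.1 j * (y.2 - u₀ y.1) j) * G (y.1, ‖y.2 - u₀ y.1‖ ^ 2)) →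
        (∀ y, |F y| ≤ C * (1 + ‖y.2‖ ^ 2)) →
        (∀ x, ∫ v, F (x, v) * localMaxwellian 1 (θ₀ x) (u₀ x) v = 0) →
        (∀ x (j : Fin 3), ∫ v, F (x, v) * v j * localMaxwellian 1 (θ₀ x) (u₀ x) v = 0) →
        (∀ x, ∫ v, F (x, v) * ‖v‖ ^ 2 * localMaxwellian 1 (θ₀ x) (u₀ x) v = 0) →
        ∀ β : ℝ, |β| ≤ β₀ → ∀ ε : ℝ, 0 < ε → ∃ τ₀ : ℝ, 0 < τ₀ ∧ ∀ τ : ℝ, τ₀ ≤ τ →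
        ∃ N₀ : ℕ, ∀ N : ℕ, N₀ ≤ N →
          ∫⁻ z, ENNReal.ofReal (Real.exp (β * ∑ i : Fin (N + 1),
              (τ * ((N : ℝ) + 1) ^ (-(1 / 3 : ℝ)))⁻¹ *
                ∫ r in (0 : ℝ)..(τ * ((N : ℝ) + 1) ^ (-(1 / 3 : ℝ))), F (((Φ N).flow r z) i)))
            ∂(localGibbsLaw σ a u₀ θ₀ N (Φ N)) ≤
          ENNReal.ofReal (Real.exp (ε * ((N : ℝ) + 1)))) →
    (∃ η₀ : ℝ, 0 < η₀ ∧ ∀ (Θ U C Λ : ℝ), 1 ≤ Θ → 0 ≤ U → 0 ≤ C → 1 ≤ Λ → ∀ σ : ℝ, 0 < σ →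
        ∃ β₀ : ℝ, 0 < β₀ ∧
        ∀ (a θ₀ : T3 → ℝ) (u₀ : T3 → V3), Continuous a → Continuous θ₀ → Continuous u₀ →
        (∀ x, Λ⁻¹ ≤ a x ∧ a x ≤ Λ) → (∀ x, Θ⁻¹ ≤ θ₀ x ∧ θ₀ x ≤ Θ) → (∀ x, ‖u₀ x‖ ≤ U) →
        σ ^ 3 * (⨆ x, a x) ≤ η₀ * ∫ x, a x →
        ∀ Φ : (N : ℕ) → HardSphereFlow (Torus.geometry (Fin 3)) (hsDiameter σ N) (N + 1),
        ∀ K : T3 × ℝ → ℝ, Continuous K →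
        ∀ F : T3 × V3 → ℝ, (∀ y, F y = K (y.1, ‖y.2 - u₀ y.1‖ ^ 2)) →
        (∀ y, |F y| ≤ C * (1 + ‖y.2‖ ^ 2)) →
        (∀ x, ∫ v, F (x, v) * localMaxwellian 1 (θ₀ x) (u₀ x) v = 0) →
        (∀ x (j : Fin 3), ∫ v, F (x, v) * v j * localMaxwellian 1 (θ₀ x) (u₀ x) v = 0) →
        (∀ x, ∫ v, F (x, v) * ‖v‖ ^ 2 * localMaxwellian 1 (θ₀ x) (u₀ x) v = 0) →
        ∀ β : ℝ, |β| ≤ β₀ → ∀ ε : ℝ, 0 < ε → ∃ τ₀ : ℝ, 0 < τ₀ ∧ ∀ τ : ℝ, τ₀ ≤ τ →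
        ∃ N₀ : ℕ, ∀ N : ℕ, N₀ ≤ N →
          ∫⁻ z, ENNReal.ofReal (Real.exp (β * ∑ i : Fin (N + 1),
              (τ * ((N : ℝ) + 1) ^ (-(1 / 3 : ℝ)))⁻¹ *
                ∫ r in (0 : ℝ)..(τ * ((N : ℝ) + 1) ^ (-(1 / 3 : ℝ))), F (((Φ N).flow r z) i)))
            ∂(localGibbsLaw σ a u₀ θ₀ N (Φ N)) ≤
          ENNReal.ofReal (Real.exp (ε * ((N : ℝ) + 1)))) →
    ∃ η₀ : ℝ, 0 < η₀ ∧ ∀ (Θ U C Λ : ℝ), 1 ≤ Θ → 0 ≤ U → 0 ≤ C → 1 ≤ Λ → ∀ σ : ℝ, 0 < σ →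
        ∃ β₀ : ℝ, 0 < β₀ ∧
        ∀ (a θ₀ : T3 → ℝ) (u₀ : T3 → V3), Continuous a → Continuous θ₀ → Continuous u₀ →
        (∀ x, Λ⁻¹ ≤ a x ∧ a x ≤ Λ) → (∀ x, Θ⁻¹ ≤ θ₀ x ∧ θ₀ x ≤ Θ) → (∀ x, ‖u₀ x‖ ≤ U) →
        σ ^ 3 * (⨆ x, a x) ≤ η₀ * ∫ x, a x →
        ∀ Φ : (N : ℕ) →
          HardSphereFlow (Torus.geometry (Fin 3)) (hsDiameter σ N) (N + 1),
        ∀ (A : T3 → Fin 3 → Fin 3 → ℝ) (b : T3 → V3) (G K : T3 × ℝ → ℝ),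
        Continuous A → Continuous b → Continuous G → Continuous K →
        ∀ F : T3 × V3 → ℝ, (∀ y, F y =
          (∑ j : Fin 3, ∑ k : Fin 3, A y.1 j k * ((y.2 - u₀ y.1) j * (y.2 - u₀ y.1) k)) +
            (∑ j : Fin 3, b y.1 j * (y.2 - u₀ y.1) j) * G (y.1, ‖y.2 - u₀ y.1‖ ^ 2) +
            K (y.1, ‖y.2 - u₀ y.1‖ ^ 2)) →
        (∀ y, |F y| ≤ C * (1 + ‖y.2‖ ^ 2)) →
        (∀ x, ∫ v, F (x, v) * localMaxwellian 1 (θ₀ x) (u₀ x) v = 0) →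
        (∀ x (j : Fin 3), ∫ v, F (x, v) * v j * localMaxwellian 1 (θ₀ x) (u₀ x) v = 0) →
        (∀ x, ∫ v, F (x, v) * ‖v‖ ^ 2 * localMaxwellian 1 (θ₀ x) (u₀ x) v = 0) →
        ∀ β : ℝ, |β| ≤ β₀ → ∀ ε : ℝ, 0 < ε → ∃ τ₀ : ℝ, 0 < τ₀ ∧ ∀ τ : ℝ, τ₀ ≤ τ →
        ∃ N₀ : ℕ, ∀ N : ℕ, N₀ ≤ N →
          ∫⁻ z, ENNReal.ofReal (Real.exp (β * ∑ i : Fin (N + 1),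
              (τ * ((N : ℝ) + 1) ^ (-(1 / 3 : ℝ)))⁻¹ *
                ∫ r in (0 : ℝ)..(τ * ((N : ℝ) + 1) ^ (-(1 / 3 : ℝ))), F (((Φ N).flow r z) i)))
            ∂(localGibbsLaw σ a u₀ θ₀ N (Φ N)) ≤
          ENNReal.ofReal (Real.exp (ε * ((N : ℝ) + 1))) := by
  rintro ⟨η₁, hη₁, h1⟩ ⟨η₂, hη₂, hR⟩
  refine ⟨min η₁ η₂, lt_min hη₁ hη₂, fun Θ U C Λ hΘ hU hC hΛ σ hσ => ?_⟩
  -- the common growth constant of the two parts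
  set Cp : ℝ := C * (7 + 10 * U ^ 2) with hCp
  have hCp0 : 0 ≤ Cp := by positivity
  obtain ⟨β₁, hβ₁, h1⟩ := h1 Θ U Cp Λ hΘ hU hCp0 hΛ σ hσ
  obtain ⟨β₂, hβ₂, hR⟩ := hR Θ U Cp Λ hΘ hU hCp0 hΛ σ hσ
  refine ⟨min β₁ β₂ / 2, by positivity, ?_⟩
  intro a θ₀ u₀ ha hθ hu hab hθb hub hguard Φ A b G K hA hb hG hK F hF hFg hF0 hFv hFE β hβ ε hε
  -- packing guards for the two rungs
  have hΛ0 : (0 : ℝ) ≤ Λ⁻¹ := inv_nonneg.2 (by linarith)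
  have hint_a : 0 ≤ ∫ x, a x := integral_nonneg fun x => hΛ0.trans (hab x).1
  have hg1 : σ ^ 3 * (⨆ x, a x) ≤ η₁ * ∫ x, a x :=
    hguard.trans (mul_le_mul_of_nonneg_right (min_le_left _ _) hint_a)
  have hg2 : σ ^ 3 * (⨆ x, a x) ≤ η₂ * ∫ x, a x :=
    hguard.trans (mul_le_mul_of_nonneg_right (min_le_right _ _) hint_a)
  have hθpos : ∀ x, 0 < θ₀ x := fun x =>
    (inv_pos.2 (by linarith : (0 : ℝ) < Θ)).trans_le (hθb x).1
  -- the split `F = F₁ + F₂`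
  set trA : T3 → ℝ := fun x => ∑ l, A x l l with htrA
  set A₀ : T3 → Fin 3 → Fin 3 → ℝ := fun x j k => A x j k - if j = k then trA x / 3 else 0 with hA₀
  set K₂ : T3 × ℝ → ℝ := fun p => K p + trA p.1 / 3 * p.2 with hK₂
  set F₁ : T3 × V3 → ℝ := fun y =>
    (∑ j, ∑ k, A₀ y.1 j k * ((y.2 - u₀ y.1) j * (y.2 - u₀ y.1) k)) +
      (∑ j, b y.1 j * (y.2 - u₀ y.1) j) * G (y.1, ‖y.2 - u₀ y.1‖ ^ 2) with hF₁
  set F₂ : T3 × V3 → ℝ := fun y => K₂ (y.1, ‖y.2 - u₀ y.1‖ ^ 2) with hF₂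
  have htr : ∀ x, ∑ j, A₀ x j j = 0 := by
    intro x; simp only [hA₀, htrA, Fin.sum_univ_three]; norm_num; ring
  have hsplit : ∀ y, F y = F₁ y + F₂ y := by
    intro y
    have hn : ‖y.2 - u₀ y.1‖ ^ 2 = ∑ j, (y.2 - u₀ y.1) j * (y.2 - u₀ y.1) j := by
      rw [EuclideanSpace.norm_sq_eq]; simp [sq]
    rw [hF y]
    simp only [hF₁, hF₂, hK₂, hA₀, sub_mul, Finset.sum_sub_distrib, ite_mul, zero_mul,
      Finset.sum_ite_eq, Finset.mem_univ, if_true, hn, Finset.mul_sum]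
    ring
  -- continuity of the parts
  have hAjk : ∀ j k, Continuous fun x => A x j k := fun j k =>
    (continuous_apply k).comp ((continuous_apply j).comp hA)
  have hbj : ∀ j, Continuous fun x => b x j := fun j => by fun_prop
  have htrAc : Continuous trA := continuous_finsetSum _ fun l _ => hAjk l l
  have hA₀jk : ∀ j k, Continuous fun x => A₀ x j k := by
    intro j k
    by_cases hjk : j = k
    · simp only [hA₀, hjk, if_true]; exact (hAjk k k).sub (htrAc.div_const 3)
    · simp only [hA₀, hjk, if_false, sub_zero]; exact hAjk j k
  have hA₀c : Continuous A₀ := continuous_pi fun j => continuous_pi fun k => hA₀jk j k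
  have hK₂c : Continuous K₂ :=
    hK.add (((htrAc.comp continuous_fst).div_const 3).mul continuous_snd)
  have hw : Continuous fun y : T3 × V3 => y.2 - u₀ y.1 := continuous_snd.sub (hu.comp continuous_fst)
  have hwj : ∀ j, Continuous fun y : T3 × V3 => (y.2 - u₀ y.1) j := fun j => by fun_prop
  have hF₂c : Continuous F₂ := hK₂c.comp (continuous_fst.prodMk (hw.norm.pow 2))
  have hF₁c : Continuous F₁ := by
    refine Continuous.add ?_ ?_
    · exact continuous_finsetSum _ fun j _ => continuous_finsetSum _ fun k _ =>
        ((hA₀jk j k).comp continuous_fst).mul ((hwj j).mul (hwj k))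
    · exact (continuous_finsetSum _ fun j _ => ((hbj j).comp continuous_fst).mul (hwj j)).mul
        (hG.comp (continuous_fst.prodMk (hw.norm.pow 2)))
  -- sections at a base point
  have hFx : ∀ (x : T3) (v : V3), F (x, v) =
      (∑ j, ∑ k, A x j k * ((v - u₀ x) j * (v - u₀ x) k)) +
        (∑ j, b x j * (v - u₀ x) j) * G (x, ‖v - u₀ x‖ ^ 2) + K (x, ‖v - u₀ x‖ ^ 2) :=
    fun x v => hF (x, v)
  -- growth of the parts
  have hC0 : 0 ≤ C := hC
  have hFg' : ∀ (x : T3) (v : V3), |F (x, v)| ≤ C * (1 + ‖v‖ ^ 2) := fun x v => hFg (x, v)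
  -- the radial profile bound at a base point, and the displacement bound `ρ ≤ 2‖v‖² + 2U²`
  have hprof : ∀ (x : T3) {ρ : ℝ}, 0 ≤ ρ →
      |K (x, ρ) + (∑ j, A x j j) / 3 * ρ| ≤ C * (1 + 2 * U ^ 2 + 2 * ρ) := fun x ρ hρ =>
    PlusOfParts.abs_radialProfile_le (A x) (b x) (u₀ x) (fun s => G (x, s))
      (fun s => K (x, s)) (F := fun v => F (x, v)) (hFx x) (hFg' x) (hub x) hρ
  have hρ2 : ∀ (x : T3) (v : V3), ‖v - u₀ x‖ ^ 2 ≤ 2 * ‖v‖ ^ 2 + 2 * U ^ 2 := by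
    intro x v
    have h1 : ‖v - u₀ x‖ ≤ ‖v‖ + ‖u₀ x‖ := norm_sub_le _ _
    have h2 : ‖v - u₀ x‖ ^ 2 ≤ (‖v‖ + ‖u₀ x‖) ^ 2 := pow_le_pow_left₀ (norm_nonneg _) h1 2
    have h3 : ‖u₀ x‖ ^ 2 ≤ U ^ 2 := pow_le_pow_left₀ (norm_nonneg _) (hub x) 2
    nlinarith [sq_nonneg (‖v‖ - ‖u₀ x‖)]
  have hF₂e : ∀ (x : T3) (v : V3),
      F₂ (x, v) = K (x, ‖v - u₀ x‖ ^ 2) + (∑ j, A x j j) / 3 * ‖v - u₀ x‖ ^ 2 := by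
    intro x v; simp only [hF₂, hK₂, htrA]
  have hF₂g' : ∀ (x : T3) (v : V3), |F₂ (x, v)| ≤ C * (1 + 2 * U ^ 2 + 2 * ‖v - u₀ x‖ ^ 2) :=
    fun x v => by rw [hF₂e]; exact hprof x (sq_nonneg _)
  have hF₂g : ∀ y, |F₂ y| ≤ Cp * (1 + ‖y.2‖ ^ 2) := by
    rintro ⟨x, v⟩
    have h2 : 1 + 2 * U ^ 2 + 2 * ‖v - u₀ x‖ ^ 2 ≤ (7 + 10 * U ^ 2) * (1 + ‖v‖ ^ 2) := by
      have e : (7 + 10 * U ^ 2) * (1 + ‖v‖ ^ 2) =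
          7 + 10 * U ^ 2 + 7 * ‖v‖ ^ 2 + 10 * (U ^ 2 * ‖v‖ ^ 2) := by ring
      rw [e]
      nlinarith [hρ2 x v, mul_nonneg (sq_nonneg U) (sq_nonneg ‖v‖), sq_nonneg U, sq_nonneg ‖v‖]
    calc |F₂ (x, v)| ≤ C * (1 + 2 * U ^ 2 + 2 * ‖v - u₀ x‖ ^ 2) := hF₂g' x v
      _ ≤ C * ((7 + 10 * U ^ 2) * (1 + ‖v‖ ^ 2)) := mul_le_mul_of_nonneg_left h2 hC0
      _ = Cp * (1 + ‖v‖ ^ 2) := by simp only [hCp]; ring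
  have hF₁g : ∀ y, |F₁ y| ≤ Cp * (1 + ‖y.2‖ ^ 2) := by
    rintro ⟨x, v⟩
    have e : F₁ (x, v) = F (x, v) - F₂ (x, v) := by rw [hsplit (x, v)]; ring
    have h2 : (1 + ‖v‖ ^ 2) + (1 + 2 * U ^ 2 + 2 * ‖v - u₀ x‖ ^ 2) ≤
        (7 + 10 * U ^ 2) * (1 + ‖v‖ ^ 2) := by
      have e : (7 + 10 * U ^ 2) * (1 + ‖v‖ ^ 2) =
          7 + 10 * U ^ 2 + 7 * ‖v‖ ^ 2 + 10 * (U ^ 2 * ‖v‖ ^ 2) := by ring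
      rw [e]
      nlinarith [hρ2 x v, mul_nonneg (sq_nonneg U) (sq_nonneg ‖v‖), sq_nonneg U, sq_nonneg ‖v‖]
    rw [e]
    calc |F (x, v) - F₂ (x, v)| ≤ |F (x, v)| + |F₂ (x, v)| := abs_sub _ _
      _ ≤ C * (1 + ‖v‖ ^ 2) + C * (1 + 2 * U ^ 2 + 2 * ‖v - u₀ x‖ ^ 2) :=
          add_le_add (hFg' x v) (hF₂g' x v)
      _ = C * ((1 + ‖v‖ ^ 2) + (1 + 2 * U ^ 2 + 2 * ‖v - u₀ x‖ ^ 2)) := by ring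
      _ ≤ C * ((7 + 10 * U ^ 2) * (1 + ‖v‖ ^ 2)) := mul_le_mul_of_nonneg_left h2 hC0
      _ = Cp * (1 + ‖v‖ ^ 2) := by simp only [hCp]; ring
  -- orthogonality of the parts at every base point
  have horth : ∀ x,
      ((∫ v, F₁ (x, v) * localMaxwellian 1 (θ₀ x) (u₀ x) v = 0) ∧
        (∀ j, ∫ v, F₁ (x, v) * v j * localMaxwellian 1 (θ₀ x) (u₀ x) v = 0) ∧
        ∫ v, F₁ (x, v) * ‖v‖ ^ 2 * localMaxwellian 1 (θ₀ x) (u₀ x) v = 0) ∧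
      ((∫ v, F₂ (x, v) * localMaxwellian 1 (θ₀ x) (u₀ x) v = 0) ∧
        (∀ j, ∫ v, F₂ (x, v) * v j * localMaxwellian 1 (θ₀ x) (u₀ x) v = 0) ∧
        ∫ v, F₂ (x, v) * ‖v‖ ^ 2 * localMaxwellian 1 (θ₀ x) (u₀ x) v = 0) := by
    intro x
    have hθx := hθpos x
    have hθΘ : θ₀ x ≤ Θ := (hθb x).2
    -- reduced growth constant
    set P : ℝ := C * (1 + 2 * U ^ 2 + 2 * Θ) with hP
    have hΘ0 : (0 : ℝ) ≤ Θ := by linarith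
    have hu2 : ‖u₀ x‖ ^ 2 ≤ U ^ 2 := pow_le_pow_left₀ (norm_nonneg _) (hub x) 2
    have hPe : ∀ t : ℝ, (1 + 2 * U ^ 2 + 2 * Θ) * (1 + t) =
        1 + 2 * U ^ 2 + 2 * Θ + t + 2 * (U ^ 2 * t) + 2 * (Θ * t) := fun t => by ring
    have hFgr : ∀ ξ : V3, |F (x, u₀ x + Real.sqrt (θ₀ x) • ξ)| ≤ P * (1 + ‖ξ‖ ^ 2) := by
      intro ξ
      have hn := KineticCurrentsWindowLDUniformSketch.ClassTruncation.norm_shift_sq_le hθx.le (u₀ x) ξ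
      have hξ : 0 ≤ ‖ξ‖ ^ 2 := sq_nonneg _
      have hθξ : θ₀ x * ‖ξ‖ ^ 2 ≤ Θ * ‖ξ‖ ^ 2 := mul_le_mul_of_nonneg_right hθΘ hξ
      have h2 : 1 + ‖u₀ x + Real.sqrt (θ₀ x) • ξ‖ ^ 2 ≤ (1 + 2 * U ^ 2 + 2 * Θ) * (1 + ‖ξ‖ ^ 2) := by
        rw [hPe]
        nlinarith [mul_nonneg hΘ0 hξ, mul_nonneg (sq_nonneg U) hξ]
      calc |F (x, u₀ x + Real.sqrt (θ₀ x) • ξ)| ≤ C * (1 + ‖u₀ x + Real.sqrt (θ₀ x) • ξ‖ ^ 2) :=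
            hFg' x _
        _ ≤ C * ((1 + 2 * U ^ 2 + 2 * Θ) * (1 + ‖ξ‖ ^ 2)) := mul_le_mul_of_nonneg_left h2 hC0
        _ = P * (1 + ‖ξ‖ ^ 2) := by simp only [hP]; ring
    have hK₂gr : ∀ ξ : V3, |K₂ (x, θ₀ x * ‖ξ‖ ^ 2)| ≤ P * (1 + ‖ξ‖ ^ 2) := by
      intro ξ
      have hρ : 0 ≤ θ₀ x * ‖ξ‖ ^ 2 := by positivity
      have h := hprof x hρ
      have e : K₂ (x, θ₀ x * ‖ξ‖ ^ 2) =
          K (x, θ₀ x * ‖ξ‖ ^ 2) + (∑ j, A x j j) / 3 * (θ₀ x * ‖ξ‖ ^ 2) := by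
        simp only [hK₂, htrA]
      have hξ : 0 ≤ ‖ξ‖ ^ 2 := sq_nonneg _
      have hθξ : θ₀ x * ‖ξ‖ ^ 2 ≤ Θ * ‖ξ‖ ^ 2 := mul_le_mul_of_nonneg_right hθΘ hξ
      have h2 : 1 + 2 * U ^ 2 + 2 * (θ₀ x * ‖ξ‖ ^ 2) ≤ (1 + 2 * U ^ 2 + 2 * Θ) * (1 + ‖ξ‖ ^ 2) := by
        rw [hPe]
        nlinarith [mul_nonneg hΘ0 hξ, mul_nonneg (sq_nonneg U) hξ]
      rw [e]
      calc |K (x, θ₀ x * ‖ξ‖ ^ 2) + (∑ j, A x j j) / 3 * (θ₀ x * ‖ξ‖ ^ 2)|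
            ≤ C * (1 + 2 * U ^ 2 + 2 * (θ₀ x * ‖ξ‖ ^ 2)) := h
        _ ≤ C * ((1 + 2 * U ^ 2 + 2 * Θ) * (1 + ‖ξ‖ ^ 2)) := mul_le_mul_of_nonneg_left h2 hC0
        _ = P * (1 + ‖ξ‖ ^ 2) := by simp only [hP]; ring
    have hFxc : Continuous fun v : V3 => F (x, v) := by
      have e : (fun v : V3 => F (x, v)) = fun v => F₁ (x, v) + F₂ (x, v) := funext fun v => hsplit _
      rw [e]
      exact (hF₁c.comp (continuous_const.prodMk continuous_id)).add
        (hF₂c.comp (continuous_const.prodMk continuous_id))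
    exact PlusOfParts.split_orth hθx (u₀ x) (A₀ x) (htr x) (b x) (fun s => G (x, s))
      (fun ρ => K₂ (x, ρ)) (hK₂c.comp (continuous_const.prodMk continuous_id))
      (F := fun v => F (x, v)) (F₁ := fun v => F₁ (x, v)) hFxc (fun v => rfl)
      (fun v => hsplit (x, v)) hFgr hK₂gr (hF0 x) (hFv x) (hFE x)
  -- the two rungs at tilt `2β`
  have hβ1 : |2 * β| ≤ β₁ := by
    rw [abs_mul, abs_two]
    have := min_le_left β₁ β₂; linarith
  have hβ2 : |2 * β| ≤ β₂ := by
    rw [abs_mul, abs_two]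
    have := min_le_right β₁ β₂; linarith
  obtain ⟨τ₁, hτ₁, H1⟩ := h1 a θ₀ u₀ ha hθ hu hab hθb hub hg1 Φ A₀ b G hA₀c hb hG F₁
    (fun y => rfl) hF₁g (fun x => (horth x).1.1) (fun x j => (horth x).1.2.1 j)
    (fun x => (horth x).1.2.2) (2 * β) hβ1 ε hε
  obtain ⟨τ₂, hτ₂, H2⟩ := hR a θ₀ u₀ ha hθ hu hab hθb hub hg2 Φ K₂ hK₂c F₂
    (fun y => rfl) hF₂g (fun x => (horth x).2.1) (fun x j => (horth x).2.2.1 j)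
    (fun x => (horth x).2.2.2) (2 * β) hβ2 ε hε
  refine ⟨max τ₁ τ₂, lt_max_iff.2 (Or.inl hτ₁), fun τ hτ => ?_⟩
  obtain ⟨N₁, hN₁⟩ := H1 τ ((le_max_left _ _).trans hτ)
  obtain ⟨N₂, hN₂⟩ := H2 τ ((le_max_right _ _).trans hτ)
  refine ⟨max N₁ N₂, fun N hN => ?_⟩
  have b1 := hN₁ N ((le_max_left _ _).trans hN)
  have b2 := hN₂ N ((le_max_right _ _).trans hN)
  have hFeq : F = fun y => F₁ y + F₂ y := funext hsplit
  rw [hFeq]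
  have hPgood : (localGibbsLaw σ a u₀ θ₀ N (Φ N)) (Φ N).goodᶜ = 0 :=
    localGibbsLaw_absolutelyContinuous σ _ _ _ N (Φ N) (Φ N).measure_compl_good
  refine (lintegral_exp_window_add_le (Φ N) hPgood hF₁c hF₂c _ β).trans ?_
  simp only [mul_assoc] at b1 b2 ⊢
  calc _ ≤ (ENNReal.ofReal (Real.exp (ε * ((N : ℝ) + 1)))) ^ (1 / 2 : ℝ) *
        (ENNReal.ofReal (Real.exp (ε * ((N : ℝ) + 1)))) ^ (1 / 2 : ℝ) := by
        gcongr
    _ = ENNReal.ofReal (Real.exp (ε * ((N : ℝ) + 1))) := by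
        rw [← ENNReal.rpow_add_of_nonneg _ _ (by norm_num) (by norm_num)]; norm_num

end Summit.AtomisticToContinuum.HydrodynamicLimit.Theorems.KineticCurrentsLDAlongFamiliesSketch

end
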